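import Summits.Schanuel.Schanuel.Theorems.RootDecomp1HSpineClear

/-!
# RootDecomp1HSpine — continuation (RootDecomp1HSpineCell): §4 cell (n,1): real unit n-cycles are presented at size one, near-c⋆-optimal and conjugation-stable (UnitParamsN … realUnitCycleN_mem_cell, Jacobian lemmas, sum_ne_zero_of_free)

Part of the six-file split (400-line rule) of lens 5's gen-11 node «CyclicSpine» = HOME/decomp-schanuel-lens-5/g11/Spine.lean
(sha256 ea4c5941…; ROUND 11 of route-Schanuel-RootDecomp1H, a THEOREM ROUND; `--supports stmt-Schanuel-30564`). All parts share the namespace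
`Summit.Schanuel.Schanuel.Theorems.RootDecomp1HSpine` and the header block of the node; the module docstring of the first part
(`RootDecomp1HSpineRigid`) describes the whole node. Sorry-free; standard axioms. Nothing here proves Schanuel; rung 0.
-/

set_option linter.dupNamespace false

noncomputable section

namespace Summit.Schanuel.Schanuel.Theorems.RootDecomp1HSpine

open Complex Set
open Literature.NumberTheory.Transcendental (exists_nsmul_mem_span_int mem_adjoin_of_mem_span_int SchanuelRank Khovanskii.ePD)
open Summit.Schanuel.Schanuel.Theses.RootDecomp1H (ProductSchanuel RelTowerSchanuel BridgeTransverse FinCS)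
open Summit.Schanuel.Schanuel.Theorems.RootDecomp1HTowerCells (trdeg_adjoin_adjoin_eq trdeg_adjoin_union_le
  trdeg_adjoin_range_le)
open Summit.Schanuel.Schanuel.Theorems.RootDecomp1HCurveHull
open Summit.Schanuel.Schanuel.Theorems.RootDecomp1HClearance (LowerRanks CounterEx InTowerHull)
open Summit.Schanuel.Schanuel.Theorems.RootDecomp1HWitness
open Summit.Schanuel.Schanuel.Theorems.RootDecomp1HGauge
open Summit.Schanuel.Schanuel.Theorems.RootDecomp1HCycles (ratCast_mem mem_closure_of_isAlgebraic_closure mem_closure_of_pair)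

/-! ## 4. Cell `(n, 1)`: real unit `n`-cycles are presented at size one, near-`c⋆`-optimal and conjugation-stable -/

section cell

variable {n : ℕ} [NeZero n]

/-- UNIT PARAMETERS: `ε_j = ±1`, `c_j ∈ {−1, 0, 1}`. -/
def UnitParamsN (ε c : Fin n → ℤ) : Prop := (∀ j, ε j = 1 ∨ ε j = -1) ∧ ∀ j, c j = -1 ∨ c j = 0 ∨ c j = 1

/-- An `n`-cycle with integer parameters `(ε, c)`: `y_{j+1} = ε_j e^{y_j} + c_j`. -/
def IsIntCycleN (ε c : Fin n → ℤ) (y : Fin n → ℂ) : Prop := ∀ j, y (j + 1) = (ε j : ℂ) * cexp (y j) + c j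

/-- An integer `n`-cycle with non-zero signs `ε` is a rational `n`-cycle (`IsCycleN`). -/
theorem IsIntCycleN.isCycleN {ε c : Fin n → ℤ} {y : Fin n → ℂ} (h : IsIntCycleN ε c y) (hε : ∀ j, ε j ≠ 0) :
    IsCycleN (fun j => (ε j : ℚ)) (fun j => (c j : ℚ)) y :=
  ⟨fun j => Int.cast_ne_zero.2 (hε j), fun j => by rw [h j]; push_cast; ring⟩

/-- A real tuple satisfying the cycle equations `t_{j+1} = ε_j e^{t_j} + c_j` is an integer `n`-cycle in `ℂ`. -/
theorem isIntCycleN_ofReal {ε c : Fin n → ℤ} {t : Fin n → ℝ} (hcyc : ∀ j, t (j + 1) = ε j * Real.exp (t j) + c j) :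
    IsIntCycleN ε c (fun j => (t j : ℂ)) := fun j => by
  simp only [hcyc j, Complex.ofReal_add, Complex.ofReal_mul, Complex.ofReal_intCast, Complex.ofReal_exp]

namespace UnitParamsN

variable {ε c : Fin n → ℤ}

omit [NeZero n] in
/-- `ε j ≠ 0`. -/
theorem ε_ne (hp : UnitParamsN ε c) (j : Fin n) : ε j ≠ 0 := by
  rcases hp.1 j with h | h <;> simp [h]

omit [NeZero n] in
/-- `ε j ^ 2 = 1`. -/
theorem ε_sq (hp : UnitParamsN ε c) (j : Fin n) : ε j ^ 2 = 1 := by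
  rcases hp.1 j with h | h <;> simp [h]

omit [NeZero n] in
/-- The sign product of unit parameters is `±1`. -/
theorem prod_ε (hp : UnitParamsN ε c) : ∏ j, ε j = 1 ∨ ∏ j, ε j = -1 :=
  sq_eq_one_iff.1 (by rw [← Finset.prod_pow]; exact Finset.prod_eq_one fun j _ => hp.ε_sq j)

end UnitParamsN

/-- THE SIZE-ONE KHOVANSKII SYSTEM of a unit `n`-cycle: `X_{j+1} − ε_j Y_j − c_j` (`j ∈ ℤ/n`). -/
def gCycN (ε c : Fin n → ℤ) (j : Fin n) : MvPolynomial (Fin n ⊕ Fin n) ℚ :=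
  MvPolynomial.X (Sum.inl (j + 1)) - MvPolynomial.C ((ε j : ℤ) : ℚ) * MvPolynomial.X (Sum.inr j) -
    MvPolynomial.C ((c j : ℤ) : ℚ)

variable {ε c : Fin n → ℤ} {y : Fin n → ℂ}

/-- A cycle solves its system. -/
theorem aeval_gCycN (h : IsIntCycleN ε c y) (j : Fin n) :
    MvPolynomial.aeval (Sum.elim y (cexp ∘ y)) (gCycN ε c j) = 0 := by
  simp only [gCycN, map_sub, map_mul, MvPolynomial.aeval_X, MvPolynomial.aeval_C, Sum.elim_inl, Sum.elim_inr,
    Function.comp_apply, eq_ratCast, Rat.cast_intCast, h j]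
  ring

/-- The system has size `≤ 1` (total degree `1`, coefficients `0, ±1`) for unit parameters. -/
theorem size_gCycN (hp : UnitParamsN ε c) (j : Fin n) :
    max (gCycN ε c j).totalDegree
      ((gCycN ε c j).support.sup fun m => max ((gCycN ε c j).coeff m).num.natAbs ((gCycN ε c j).coeff m).den) ≤ 1 := by
  classical
  have hint : ∀ z : ℤ, z.natAbs ≤ 1 → max ((z : ℚ)).num.natAbs ((z : ℚ)).den ≤ 1 := fun z hz => by
    rw [Rat.num_intCast, Rat.den_intCast]; exact max_le hz le_rfl
  refine max_le ?_ (Finset.sup_le fun m _ => ?_)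
  · refine (MvPolynomial.totalDegree_sub _ _).trans (max_le ((MvPolynomial.totalDegree_sub _ _).trans (max_le ?_ ?_)) ?_)
    · rw [MvPolynomial.totalDegree_X]
    · exact (MvPolynomial.totalDegree_mul _ _).trans (by rw [MvPolynomial.totalDegree_C, MvPolynomial.totalDegree_X])
    · rw [MvPolynomial.totalDegree_C]; exact zero_le_one
  · simp only [gCycN, MvPolynomial.coeff_sub, MvPolynomial.coeff_C_mul, MvPolynomial.coeff_X, MvPolynomial.coeff_C]
    have hne : Finsupp.single (Sum.inl (j + 1) : Fin n ⊕ Fin n) 1 ≠ Finsupp.single (Sum.inr j) 1 := fun h =>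
      Sum.inl_ne_inr (Finsupp.single_left_injective one_ne_zero h)
    have hne0 : ∀ s : Fin n ⊕ Fin n, (0 : (Fin n ⊕ Fin n) →₀ ℕ) ≠ Finsupp.single s 1 := fun s h =>
      (Finsupp.single_ne_zero.2 one_ne_zero) h.symm
    by_cases h1 : Finsupp.single (Sum.inl (j + 1) : Fin n ⊕ Fin n) 1 = m
    · rw [if_pos h1, if_neg (fun h2 => hne (h1.trans h2.symm)), if_neg (fun h3 => hne0 _ (h3.trans h1.symm))]
      simp
    · rw [if_neg h1]
      by_cases h2 : Finsupp.single (Sum.inr j : Fin n ⊕ Fin n) 1 = m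
      · rw [if_pos h2, if_neg (fun h3 => hne0 _ (h3.trans h2.symm)), zero_sub, mul_one, sub_zero, ← Int.cast_neg]
        refine hint _ ?_
        rcases hp.1 j with h | h <;> simp [h]
      · rw [if_neg h2, mul_zero, sub_zero, zero_sub]
        by_cases h3 : (0 : (Fin n ⊕ Fin n) →₀ ℕ) = m
        · rw [if_pos h3, ← Int.cast_neg]
          refine hint _ ?_
          rcases hp.2 j with h | h | h <;> simp [h]
        · rw [if_neg h3, neg_zero]
          simp

/-- `∂g_i/∂X_j = [j = i + 1]`. -/
theorem pderiv_inl_gCycN (j i : Fin n) :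
    MvPolynomial.pderiv (Sum.inl j) (gCycN ε c i) = if i + 1 = j then 1 else 0 := by
  simp [gCycN, MvPolynomial.pderiv_X, Pi.single_apply]

/-- `∂g_i/∂Y_j = −ε_i [j = i]`. -/
theorem pderiv_inr_gCycN (j i : Fin n) :
    MvPolynomial.pderiv (Sum.inr j) (gCycN ε c i) = if i = j then -MvPolynomial.C ((ε i : ℤ) : ℚ) else 0 := by
  by_cases h : i = j
  · subst h; simp [gCycN, MvPolynomial.pderiv_X]
  · simp [gCycN, MvPolynomial.pderiv_X, h]

/-- THE EXPONENTIAL JACOBIAN of the system at `(y, e^y)`: entry `(i, j)` is `[j = i + 1] − ε_i e^{y_i} [j = i]`. -/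
theorem jacobian_entry (i j : Fin n) :
    MvPolynomial.aeval (Sum.elim y (cexp ∘ y)) (Khovanskii.ePD j (gCycN ε c i)) =
      (if i + 1 = j then (1 : ℂ) else 0) - (if i = j then (ε i : ℂ) * cexp (y i) else 0) := by
  rw [Khovanskii.ePD, map_add, map_mul, pderiv_inl_gCycN, pderiv_inr_gCycN, MvPolynomial.aeval_X, Sum.elim_inr,
    Function.comp_apply]
  by_cases h1 : i + 1 = j <;> by_cases h2 : i = j
  · rw [if_pos h1, if_pos h1, if_pos h2, if_pos h2]; subst h2
    simp only [map_one, map_neg, MvPolynomial.aeval_C, eq_ratCast, Rat.cast_intCast]; ring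
  · rw [if_pos h1, if_pos h1, if_neg h2, if_neg h2, map_one, map_zero, mul_zero, add_zero, sub_zero]
  · rw [if_neg h1, if_neg h1, if_pos h2, if_pos h2]; subst h2
    simp only [map_zero, map_neg, MvPolynomial.aeval_C, eq_ratCast, Rat.cast_intCast]; ring
  · rw [if_neg h1, if_neg h1, if_neg h2, if_neg h2]; simp

/-- The Jacobian acts on a vector `w` by `(J w)_i = w_{i+1} − ε_i e^{y_i} w_i`. -/
theorem jacobian_mulVec (w : Fin n → ℂ) (i : Fin n) :
    ((Matrix.of fun i j => MvPolynomial.aeval (Sum.elim y (cexp ∘ y)) (Khovanskii.ePD j (gCycN ε c i))).mulVec w) i =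
      w (i + 1) - (ε i : ℂ) * cexp (y i) * w i := by
  simp only [Matrix.mulVec, dotProduct, Matrix.of_apply, jacobian_entry, sub_mul, ite_mul, one_mul, zero_mul,
    Finset.sum_sub_distrib, Finset.sum_ite_eq, Finset.mem_univ, if_true]

/-- **NON-DEGENERACY BY THE CYCLE PRODUCT.**  If `∏_j ε_j e^{y_j} ≠ 1` the exponential Jacobian of the system is
invertible: a kernel vector `w` satisfies `w_{j+1} = ε_j e^{y_j} w_j` around the cycle, whence `(1 − ∏ ε_j e^{y_j}) · ∏ w_j = 0`,
so some `w_j = 0`, and a zero coordinate propagates around the cycle (`cyclic_induction`). -/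
theorem det_jacobian_gCycN_ne_zero (hD : ∏ j, (ε j : ℂ) * cexp (y j) ≠ 1) :
    (Matrix.of fun i j => MvPolynomial.aeval (Sum.elim y (cexp ∘ y)) (Khovanskii.ePD j (gCycN ε c i))).det ≠ 0 := by
  classical
  intro hdet
  obtain ⟨w, hw0, hw⟩ := Matrix.exists_mulVec_eq_zero_iff.2 hdet
  have step : ∀ i, w (i + 1) = (ε i : ℂ) * cexp (y i) * w i := fun i => by
    have := congr_fun hw i
    rwa [jacobian_mulVec, Pi.zero_apply, sub_eq_zero] at this
  have h1 : ∏ i, w (i + 1) = ∏ i, w i :=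
    Fintype.prod_equiv (Equiv.addRight 1) (fun i => w (i + 1)) w fun _ => rfl
  have h2 : ∏ i, w (i + 1) = (∏ j, (ε j : ℂ) * cexp (y j)) * ∏ i, w i := by
    rw [← Finset.prod_mul_distrib]; exact Finset.prod_congr rfl fun i _ => step i
  have h3 : (1 - ∏ j, (ε j : ℂ) * cexp (y j)) * ∏ i, w i = 0 := by
    rw [sub_mul, one_mul, ← h2, h1, sub_self]
  rcases mul_eq_zero.1 h3 with h | h
  · exact hD (sub_eq_zero.1 h).symm
  · obtain ⟨i₀, -, hi₀⟩ := Finset.prod_eq_zero_iff.1 h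
    exact hw0 (funext fun j =>
      cyclic_induction (P := fun j => w j = 0) (fun f hf => by rw [step f, hf, mul_zero]) hi₀ j)

omit [NeZero n] in
/-- For REAL unit parameters with `Σ t_j ≠ 0` the cycle product is not `1` (`∏ ε_j = ±1`, `e^{Σ t} = 1 ⟺ Σ t = 0`). -/
theorem cycleProd_ne_one (hp : UnitParamsN ε c) (t : Fin n → ℝ) (hsum : ∑ j, t j ≠ 0) :
    ∏ j, (ε j : ℂ) * cexp (t j : ℂ) ≠ 1 := by
  rw [Finset.prod_mul_distrib, ← Complex.exp_sum, ← Complex.ofReal_sum, ← Complex.ofReal_exp]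
  have hcast : (∏ j, (ε j : ℂ)) = ((∏ j, ε j : ℤ) : ℂ) := by push_cast; rfl
  rw [hcast]
  have hpos := Real.exp_pos (∑ j, t j)
  rcases hp.prod_ε with h | h <;> rw [h]
  · rw [Int.cast_one, one_mul, Ne, ← Complex.ofReal_one, Complex.ofReal_inj, Real.exp_eq_one_iff]; exact hsum
  · rw [Int.cast_neg, Int.cast_one, neg_one_mul, ← Complex.ofReal_neg, Ne, ← Complex.ofReal_one, Complex.ofReal_inj]
    intro h'; linarith

/-- For a `ℚ`-free real tuple the hypothesis `Σ t_j ≠ 0` is automatic (`Σ t_j = 0` is itself a `ℚ`-relation): at the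
`ℚ`-free points of the census the presentation hypothesis of `presented_realUnitCycleN` therefore holds for free. -/
theorem sum_ne_zero_of_free {t : Fin n → ℝ} (hy : LinearIndependent ℚ (fun j => (t j : ℂ))) : ∑ j, t j ≠ 0 := by
  intro h0
  have hsum : ∑ j, (1 : ℚ) • ((t j : ℝ) : ℂ) = 0 := by
    simp only [one_smul]
    rw [← Complex.ofReal_sum, h0, Complex.ofReal_zero]
  exact one_ne_zero ((Fintype.linearIndependent_iff.1 hy) (fun _ => (1 : ℚ)) hsum 0)

/-- **A REAL UNIT `n`-CYCLE IN THE BALL WITH `Σ t_j ≠ 0` IS PRESENTED AT SIZE ONE.** -/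
theorem presented_realUnitCycleN (hp : UnitParamsN ε c) {t : Fin n → ℝ}
    (hcyc : ∀ j, t (j + 1) = ε j * Real.exp (t j) + c j) (hball : ∀ j, |t j| ≤ 4) (hsum : ∑ j, t j ≠ 0) :
    Presented n 1 (fun j => (t j : ℂ)) := by
  have hint : IsIntCycleN ε c (fun j => (t j : ℂ)) := isIntCycleN_ofReal hcyc
  refine ⟨⟨gCycN ε c, size_gCycN hp, aeval_gCycN hint, det_jacobian_gCycN_ne_zero (cycleProd_ne_one hp t hsum)⟩, ?_⟩
  rw [pi_norm_le_iff_of_nonneg (by positivity)]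
  intro j
  rw [Complex.norm_real, Real.norm_eq_abs]
  exact (hball j).trans (by norm_num)

/-- Nothing is presented at size `0` (a size-`0` polynomial is `0`: every coefficient has denominator `≥ 1`). -/
theorem not_presented_zero (y : Fin n → ℂ) : ¬ Presented n 0 y := by
  classical
  rintro ⟨⟨g, hsize, -, hdet⟩, -⟩
  apply hdet
  have hg : g 0 = 0 := by
    ext m
    rw [MvPolynomial.coeff_zero]
    by_contra hm
    have hmem : m ∈ (g 0).support := MvPolynomial.mem_support_iff.2 hm
    have h1 := (le_max_right _ _).trans (hsize 0)
    have h2 := (Finset.le_sup (f := fun m => max ((g 0).coeff m).num.natAbs ((g 0).coeff m).den) hmem).trans h1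
    have h3 := (le_max_right _ _).trans h2
    exact absurd h3 (not_le.2 (Rat.den_pos _))
  exact Matrix.det_eq_zero_of_row_eq_zero 0 fun j => by simp [Matrix.of_apply, hg, Khovanskii.ePD]

/-- **PRESENTED AT SIZE ONE ⟹ NEAR-`c⋆`-OPTIMAL** (with `c⋆ = 1`): the first inline hypothesis of the items, verbatim. -/
theorem nearOpt_of_presented_one (h : Presented n 1 y) : NearOpt n 1 y :=
  ⟨h, fun c' hc' ⟨y', _, hy'⟩ => by
    obtain rfl : c' = 0 := by omega
    exact not_presented_zero y' hy'⟩

omit [NeZero n] in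
/-- A real tuple is conjugation-stable (the second inline hypothesis of the items). -/
theorem conjStable_real (t : Fin n → ℝ) : ConjStable (fun j => (t j : ℂ)) := fun j => by
  rw [Complex.conj_ofReal]; exact Submodule.subset_span ⟨j, rfl⟩

/-- **THE CELL `(n, 1)` IS INHABITED BY CYCLES**: a real unit `n`-cycle in the ball with `Σ t_j ≠ 0` is a near-`c⋆`-optimal
(`c⋆ = 1`), conjugation-stable point of cell `(n, 1)` — unconditionally. -/
theorem realUnitCycleN_mem_cell (hp : UnitParamsN ε c) {t : Fin n → ℝ}
    (hcyc : ∀ j, t (j + 1) = ε j * Real.exp (t j) + c j) (hball : ∀ j, |t j| ≤ 4) (hsum : ∑ j, t j ≠ 0) :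
    NearOpt n 1 (fun j => (t j : ℂ)) ∧ ConjStable (fun j => (t j : ℂ)) :=
  ⟨nearOpt_of_presented_one (presented_realUnitCycleN hp hcyc hball hsum), conjStable_real t⟩

end cell

end Summit.Schanuel.Schanuel.Theorems.RootDecomp1HSpine
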